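import Summits.Schanuel.Schanuel.Theorems.ZilberEacMovingGraphPureLemmas
import Summits.Schanuel.Schanuel.Theorems.ZilberEacMovingLine
import HarnessLib

/-!
# The pure moving target `e^{z} = A(z)` over EVERY graph base of degree `≥ 2`: density

Zilber's Exponential-Algebraic Closedness, case ladder (host summit Schanuel, cell `pub-schanuel`,
seat 2, gen 8).  For EVERY `p ∈ ℂ[x]` with `deg p ≥ 2` and every `A ∈ ℂ[x]` with `deg A ≥ 1` the
exponential points `(x, p(x), A(x), e^{p(x)})`, `e^{x} = A(x)`, of the surface
`{x₁ = p(x₀), y₀ = A(x₀)} ⊆ ℂ² × ℂ²` are ZARISKI DENSE (`unprojectedDense_movingGraph_zero`) — no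
condition on the leading coefficient (the lattice-centre theorems `unprojectedDense_movingGraph`,
`unprojectedDense_movingGraph_oscillatory` needed a sign).  Mechanism: THEOREM G
(`unprojectedDense_of_growth`) on `x₁ = p(x)` along the roots `x = u + it`, `u = d log m + O(1)`,
`t = 2πm + O(1)` (`exists_controlled_solutions`), with the second-order expansion
`re_eval_near_lattice`: `|Re p(x)| ≳ t^D` if `Re(lc i^D) ≠ 0` (`re_lower_of_re_ne_zero`), and
`≳ u t^{D-1} ≍ m^{D-1} log m` if `Re(lc i^D) = 0` (`re_lower_of_re_eq_zero`: then `lc i^{D-1} ∈ ℝ ∖ {0}`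
and the moving centre `u ≍ log m` de-resonates), against `log ‖p(x)‖ = O(log m)`.

HONEST FRAMING: an instance family of Mantova–Masser's OPEN density question; `EC(3,2)` OPEN;
NOT Schanuel's conjecture; EAC ⇏ SC.
-/

noncomputable section

open Complex MvPolynomial Filter Topology
open Literature.NumberTheory.Transcendental Literature.ModelTheory.Zilber

set_option linter.dupNamespace false

namespace Summit.Schanuel.Schanuel.Theorems

/-! ## Real-arithmetic steps (isolated to keep the main proof light) -/

/-- Geometry of a controlled root `x = u + it`: `|u - d ℓ| ≤ C`, `|t - 2πm| ≤ C` with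
`C + 1 ≤ d ℓ`, `d ℓ + 2C ≤ π m` give `1 ≤ u ≤ t`, `πm ≤ t ≤ 3πm`. [folklore] -/
theorem control_geometry_aux {u t d C ℓ m : ℝ} (hre : |u - d * ℓ| ≤ C) (him : |t - 2 * Real.pi * m| ≤ C)
    (h1 : C + 1 ≤ d * ℓ) (h2 : d * ℓ + 2 * C ≤ Real.pi * m) :
    1 ≤ u ∧ u ≤ d * ℓ + C ∧ d * ℓ - C ≤ u ∧ Real.pi * m ≤ t ∧ t ≤ 3 * Real.pi * m ∧ u ≤ t ∧
      1 ≤ Real.pi * m := by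
  rw [abs_le] at hre him
  have hC : 0 ≤ C := by linarith [hre.1, hre.2]
  have hpm : C + 1 ≤ Real.pi * m := by linarith
  refine ⟨by linarith, by linarith, by linarith, by linarith, by linarith, by linarith, by linarith⟩

/-- The denominator: `log(2 + ‖p(x)‖) ≤ log(2 + B_p 2^D) + D log(3π) + D log m` for `x = u + it`,
`0 ≤ u ≤ t`, `1 ≤ t ≤ 3πm`. [folklore] -/
theorem log_norm_eval_le_aux (p : Polynomial ℂ) {x : ℂ} {m : ℝ} (hm : 0 < m) (hu0 : 0 ≤ x.re)
    (hut : x.re ≤ x.im) (ht1 : 1 ≤ x.im) (htup : x.im ≤ 3 * Real.pi * m) :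
    Real.log (2 + ‖p.eval x‖) ≤
      Real.log (2 + (∑ i ∈ Finset.range (p.natDegree + 1), ‖p.coeff i‖) * 2 ^ p.natDegree) +
        p.natDegree * Real.log (3 * Real.pi) + p.natDegree * Real.log m := by
  set Bp : ℝ := ∑ i ∈ Finset.range (p.natDegree + 1), ‖p.coeff i‖ with hBp
  have hBp0 : 0 ≤ Bp := Finset.sum_nonneg fun _ _ => norm_nonneg _
  set D : ℕ := p.natDegree
  have hxn : ‖x‖ ≤ 2 * x.im := by
    have h := Complex.norm_le_abs_re_add_abs_im x
    rw [abs_of_nonneg hu0, abs_of_pos (by linarith)] at h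
    linarith
  have ht0 : 0 < x.im := by linarith
  have hmax : max 1 ‖x‖ ≤ 2 * x.im := max_le (by linarith) hxn
  have hpx : ‖p.eval x‖ ≤ Bp * (2 ^ D * x.im ^ D) := by
    rw [← mul_pow]
    exact (Literature.ModelTheory.Zilber.norm_eval_le_sum_mul_pow p x).trans
      (mul_le_mul_of_nonneg_left (pow_le_pow_left₀ (zero_le_one.trans (le_max_left _ _)) hmax _)
        hBp0)
  have htD : 1 ≤ x.im ^ D := one_le_pow₀ ht1
  calc Real.log (2 + ‖p.eval x‖) ≤ Real.log ((2 + Bp * 2 ^ D) * x.im ^ D) := by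
        refine Real.log_le_log (by positivity) ?_
        have : 0 ≤ Bp * 2 ^ D := by positivity
        nlinarith
    _ = Real.log (2 + Bp * 2 ^ D) + D * Real.log x.im := by
        rw [Real.log_mul (by positivity) (by positivity), Real.log_pow]
    _ ≤ Real.log (2 + Bp * 2 ^ D) + D * (Real.log (3 * Real.pi) + Real.log m) := by
        gcongr
        rw [← Real.log_mul (by positivity) hm.ne']
        exact Real.log_le_log ht0 (by linarith)
    _ = _ := by ring

/-- Case `Re(lc i^D) = 0`: from the expansion `|R - (c₁ + D y u) t^{D-1}| ≤ B (1+u)² t^{D-2}` and the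
log-linear thresholds, `|R| ≥ (D|y|/4) π^{D-1} m`. [folklore] -/
theorem re_lower_of_re_eq_zero {D : ℕ} (hD : 2 ≤ D) {y c₁ B d C u t m R ℓ : ℝ} (hy : y ≠ 0)
    (hB : 0 ≤ B) (hm : 1 ≤ m) (hu1 : 1 ≤ u) (huup : u ≤ d * ℓ + C) (hulo : d * ℓ - C ≤ u)
    (htlo : Real.pi * m ≤ t) (h1 : C + 1 + 2 * |c₁| / (D * |y|) ≤ d * ℓ)
    (h3 : 16 * B * d * ℓ + 16 * B * C ≤ D * |y| * Real.pi * m)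
    (hkey : |R - (c₁ + D * y * u) * t ^ (D - 1)| ≤ B * (1 + u) ^ 2 * t ^ (D - 2)) :
    D * |y| / 4 * Real.pi ^ (D - 1) * m ≤ |R| := by
  have hDpos : (0 : ℝ) < D := by exact_mod_cast (show 0 < D by omega)
  have hypos : 0 < |y| := abs_pos.2 hy
  have ht0 : 0 < t := by nlinarith [Real.pi_gt_three]
  -- `|c₁ + D y u| ≥ (D|y|/2) u`
  have hmain : D * |y| / 2 * u ≤ |c₁ + D * y * u| := by
    have h4 : |D * y * u| = D * |y| * u := by
      rw [abs_mul, abs_mul, abs_of_pos hDpos, abs_of_nonneg (show (0 : ℝ) ≤ u by linarith)]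
    have h5 : |D * y * u| - |c₁| ≤ |c₁ + D * y * u| := by
      have := abs_sub_abs_le_abs_sub (D * y * u) (-c₁)
      rw [abs_neg, sub_neg_eq_add, add_comm] at this
      exact this
    have h6 : 2 * |c₁| / (D * |y|) ≤ u := by linarith
    rw [div_le_iff₀ (by positivity)] at h6
    nlinarith
  -- the error is `≤ (D|y|/4) u t^{D-1}`
  have herr : B * (1 + u) ^ 2 * t ^ (D - 2) ≤ D * |y| / 4 * u * t ^ (D - 1) := by
    have h4 : B * (1 + u) ^ 2 ≤ 4 * B * u ^ 2 := by
      have : (1 + u) ^ 2 ≤ 4 * u ^ 2 := by nlinarith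
      calc B * (1 + u) ^ 2 ≤ B * (4 * u ^ 2) := mul_le_mul_of_nonneg_left this hB
        _ = 4 * B * u ^ 2 := by ring
    have h5 : 16 * B * u ≤ D * |y| * t := by
      have h51 : 16 * B * u ≤ 16 * B * (d * ℓ + C) := mul_le_mul_of_nonneg_left huup (by positivity)
      have h52 : D * |y| * (Real.pi * m) ≤ D * |y| * t := mul_le_mul_of_nonneg_left htlo (by positivity)
      linarith
    have htpow : t ^ (D - 1) = t * t ^ (D - 2) := by
      rw [← pow_succ']; congr 1; omega
    rw [htpow]
    have ht2 : 0 ≤ t ^ (D - 2) := by positivity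
    have h6 : B * (1 + u) ^ 2 ≤ D * |y| / 4 * u * t := by
      have hu0 : 0 ≤ u := by linarith
      nlinarith
    calc B * (1 + u) ^ 2 * t ^ (D - 2) ≤ (D * |y| / 4 * u * t) * t ^ (D - 2) :=
          mul_le_mul_of_nonneg_right h6 ht2
      _ = D * |y| / 4 * u * (t * t ^ (D - 2)) := by ring
  have h7 : |(c₁ + D * y * u) * t ^ (D - 1)| - B * (1 + u) ^ 2 * t ^ (D - 2) ≤ |R| := by
    have := abs_sub_abs_le_abs_sub ((c₁ + D * y * u) * t ^ (D - 1))
      ((c₁ + D * y * u) * t ^ (D - 1) - R)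
    rw [sub_sub_cancel, abs_sub_comm] at this
    linarith
  have h8 : |(c₁ + D * y * u) * t ^ (D - 1)| = |c₁ + D * y * u| * t ^ (D - 1) := by
    rw [abs_mul, abs_of_nonneg (show (0 : ℝ) ≤ t ^ (D - 1) by positivity)]
  have htD1 : Real.pi ^ (D - 1) * m ≤ t ^ (D - 1) := by
    calc Real.pi ^ (D - 1) * m ≤ Real.pi ^ (D - 1) * m ^ (D - 1) :=
          mul_le_mul_of_nonneg_left (le_self_pow₀ hm (by omega)) (by positivity)
      _ = (Real.pi * m) ^ (D - 1) := by rw [mul_pow]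
      _ ≤ t ^ (D - 1) := pow_le_pow_left₀ (by positivity) htlo _
  have h9 : D * |y| / 2 * u * t ^ (D - 1) ≤ |c₁ + D * y * u| * t ^ (D - 1) :=
    mul_le_mul_of_nonneg_right hmain (by positivity)
  calc D * |y| / 4 * Real.pi ^ (D - 1) * m = D * |y| / 4 * 1 * (Real.pi ^ (D - 1) * m) := by ring
    _ ≤ D * |y| / 4 * u * t ^ (D - 1) := by gcongr
    _ ≤ |R| := by linarith

/-- Case `Re(lc i^D) = X ≠ 0`: from `|R - (X t^D + (c₁ + D y u) t^{D-1})| ≤ B (1+u)² t^{D-2}` and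
the thresholds, `|R| ≥ (|X|/2) π^D m`. [folklore] -/
theorem re_lower_of_re_ne_zero {D : ℕ} (hD : 2 ≤ D) {X y c₁ B d C u t m R ℓ : ℝ} (hX : X ≠ 0)
    (hB : 0 ≤ B) (hm : 1 ≤ m) (hu1 : 1 ≤ u) (huup : u ≤ d * ℓ + C) (htlo : Real.pi * m ≤ t)
    (h3 : D * |y| * d * ℓ + (D * |y| * C + |c₁|) ≤ |X| / 4 * Real.pi * m)
    (h4 : (d * ℓ + (1 + C)) ^ 2 ≤ |X| / 4 * Real.pi / (B + 1) * m)
    (hkey : |R - (X * t ^ D + (c₁ + D * y * u) * t ^ (D - 1))| ≤ B * (1 + u) ^ 2 * t ^ (D - 2)) :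
    |X| / 2 * Real.pi ^ D * m ≤ |R| := by
  have hDpos : (0 : ℝ) < D := by exact_mod_cast (show 0 < D by omega)
  have hXpos : 0 < |X| := abs_pos.2 hX
  have hpm : 1 ≤ Real.pi * m := by nlinarith [Real.pi_gt_three]
  have ht0 : 0 < t := by linarith
  have hcorr1 : |c₁ + D * y * u| * t ^ (D - 1) ≤ |X| / 4 * t ^ D := by
    have h5 : |c₁ + D * y * u| ≤ |c₁| + D * |y| * u := by
      refine (abs_add_le _ _).trans ?_
      rw [abs_mul, abs_mul, abs_of_pos hDpos, abs_of_nonneg (show (0 : ℝ) ≤ u by linarith)]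
    have h6 : |c₁| + D * |y| * u ≤ |X| / 4 * t := by
      have : D * |y| * u ≤ D * |y| * (d * ℓ + C) := mul_le_mul_of_nonneg_left huup (by positivity)
      nlinarith [Real.pi_pos]
    have htpow : t ^ D = t * t ^ (D - 1) := by
      rw [← pow_succ']; congr 1; omega
    rw [htpow]
    have ht1' : 0 ≤ t ^ (D - 1) := by positivity
    calc |c₁ + D * y * u| * t ^ (D - 1) ≤ (|X| / 4 * t) * t ^ (D - 1) :=
          mul_le_mul_of_nonneg_right (h5.trans h6) ht1'
      _ = |X| / 4 * (t * t ^ (D - 1)) := by ring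
  have hcorr2 : B * (1 + u) ^ 2 * t ^ (D - 2) ≤ |X| / 4 * t ^ D := by
    have h5 : (1 + u) ^ 2 ≤ (d * ℓ + (1 + C)) ^ 2 := by
      have : 1 + u ≤ d * ℓ + (1 + C) := by linarith
      exact pow_le_pow_left₀ (by linarith) this 2
    have h6 : B * (1 + u) ^ 2 ≤ |X| / 4 * Real.pi * m := by
      have h7 : B * (1 + u) ^ 2 ≤ B * (|X| / 4 * Real.pi / (B + 1) * m) :=
        mul_le_mul_of_nonneg_left (h5.trans h4) hB
      have h8 : B * (|X| / 4 * Real.pi / (B + 1) * m) ≤ |X| / 4 * Real.pi * m := by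
        rw [show B * (|X| / 4 * Real.pi / (B + 1) * m) = (B / (B + 1)) * (|X| / 4 * Real.pi * m) by
          field_simp]
        exact mul_le_of_le_one_left (by positivity) ((div_le_one (by linarith)).2 (by linarith))
      linarith
    have h9 : Real.pi * m ≤ t * t := by nlinarith
    have htpow : t ^ D = t * t * t ^ (D - 2) := by
      rw [← pow_two, ← pow_add]; congr 1; omega
    rw [htpow]
    have ht2 : 0 ≤ t ^ (D - 2) := by positivity
    have h10 : B * (1 + u) ^ 2 ≤ |X| / 4 * (t * t) :=
      calc B * (1 + u) ^ 2 ≤ |X| / 4 * Real.pi * m := h6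
        _ = |X| / 4 * (Real.pi * m) := by ring
        _ ≤ |X| / 4 * (t * t) := mul_le_mul_of_nonneg_left h9 (by positivity)
    calc B * (1 + u) ^ 2 * t ^ (D - 2) ≤ |X| / 4 * (t * t) * t ^ (D - 2) :=
          mul_le_mul_of_nonneg_right h10 ht2
      _ = |X| / 4 * (t * t * t ^ (D - 2)) := by ring
  have h5 : |X * t ^ D + (c₁ + D * y * u) * t ^ (D - 1)| - B * (1 + u) ^ 2 * t ^ (D - 2) ≤ |R| := by
    have := abs_sub_abs_le_abs_sub (X * t ^ D + (c₁ + D * y * u) * t ^ (D - 1))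
      (X * t ^ D + (c₁ + D * y * u) * t ^ (D - 1) - R)
    rw [sub_sub_cancel, abs_sub_comm] at this
    linarith
  have h6 : |X| * t ^ D - |c₁ + D * y * u| * t ^ (D - 1) ≤
      |X * t ^ D + (c₁ + D * y * u) * t ^ (D - 1)| := by
    have := abs_sub_abs_le_abs_sub (X * t ^ D) (-((c₁ + D * y * u) * t ^ (D - 1)))
    rw [abs_neg, sub_neg_eq_add, abs_mul X, abs_of_nonneg (by positivity : 0 ≤ t ^ D), abs_mul,
      abs_of_nonneg (by positivity : 0 ≤ t ^ (D - 1))] at this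
    exact this
  have htD : Real.pi ^ D * m ≤ t ^ D := by
    calc Real.pi ^ D * m ≤ Real.pi ^ D * m ^ D :=
          mul_le_mul_of_nonneg_left (le_self_pow₀ hm (by omega)) (by positivity)
      _ = (Real.pi * m) ^ D := by rw [mul_pow]
      _ ≤ t ^ D := pow_le_pow_left₀ (by positivity) htlo _
  calc |X| / 2 * Real.pi ^ D * m = |X| / 2 * (Real.pi ^ D * m) := by ring
    _ ≤ |X| / 2 * t ^ D := mul_le_mul_of_nonneg_left htD (by positivity)
    _ ≤ |R| := by linarith

/-- The final comparison `κ · m/(L + D log m) ≤ |R| / log(2 + ‖p‖)`. [folklore] -/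
theorem ratio_lower_aux {κ m L D' R den : ℝ} (hnum : κ * m ≤ |R|)
    (hden : den ≤ L + D' * Real.log m) (hdenpos : 0 < den) :
    κ * (m / (L + D' * Real.log m)) ≤ |R| / den := by
  have hL : 0 < L + D' * Real.log m := hdenpos.trans_le hden
  calc κ * (m / (L + D' * Real.log m)) = κ * m / (L + D' * Real.log m) := by ring
    _ ≤ |R| / (L + D' * Real.log m) := div_le_div_of_nonneg_right hnum hL.le
    _ ≤ |R| / den := div_le_div_of_nonneg_left (abs_nonneg _) hdenpos hden

/-! ## The density theorem -/

/-- **Density of `{x₁ = p(x₀), y₀ = A(x₀)}` for every `deg p ≥ 2`, `deg A ≥ 1`.** (new)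
[cite: MantovaMasser2023, §1 Further remarks] -/
theorem unprojectedDense_movingGraph_zero {p : Polynomial ℂ} (hp : 2 ≤ p.natDegree)
    {A : Polynomial ℂ} (hA : 0 < A.natDegree) :
    UnprojectedDense (movingGraphSurface p A 0) := by
  classical
  have hA0 : A ≠ 0 := by rintro rfl; simp at hA
  set D : ℕ := p.natDegree with hDdef
  set α : ℂ := p.leadingCoeff with hα
  have hp0 : p ≠ 0 := by rintro rfl; simp [hDdef] at hp
  have hα0 : α ≠ 0 := Polynomial.leadingCoeff_ne_zero.2 hp0
  have hDpos : (0 : ℝ) < D := by exact_mod_cast (show 0 < D by omega)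
  set d : ℝ := (A.natDegree : ℝ) with hd
  have hdpos : 0 < d := by rw [hd]; exact_mod_cast hA
  set X : ℝ := (α * I ^ D).re with hX
  set y : ℝ := (α * I ^ (D - 1)).re with hy
  set c₁ : ℝ := (p.coeff (D - 1) * I ^ (D - 1)).re with hc₁
  obtain ⟨B, hB0, hB⟩ := re_eval_near_lattice p hp
  set Bp : ℝ := ∑ i ∈ Finset.range (p.natDegree + 1), ‖p.coeff i‖ with hBp
  have hBp0 : 0 ≤ Bp := Finset.sum_nonneg fun _ _ => norm_nonneg _
  -- ### the roots of `e^{x} = A(x)` near `2πim + d log m`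
  have hslow : (0 : ℝ) * A.natDegree + max ((0 : ℝ) * A.natDegree) 0 * (0 : Polynomial ℂ).natDegree <
      A.natDegree := by
    simp only [zero_mul, max_self, Polynomial.natDegree_zero, Nat.cast_zero, mul_zero, add_zero]
    exact_mod_cast hA
  have hsol := eventually_exists_solution_realLine 0 0 hA0 0 hslow
  obtain ⟨x, M, C, -, hMm, hM1, hsys, hctrl⟩ :=
    exists_controlled_solutions (a := ((0 : ℝ) : ℂ)) (b := 0) (F := 0) hA0 (q := 1) one_ne_zero hsol
  have hsys' : ∀ m, exp (x m) = A.eval (x m) := fun m => by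
    have h := hsys m
    rwa [Polynomial.eval_zero, mul_zero, add_zero] at h
  -- ### the exponential points and THEOREM G
  set pt : ℕ → Fin 2 ⊕ Fin 2 → ℂ := fun m =>
    Sum.elim ![x m, p.eval (x m)] ![exp (x m), exp (p.eval (x m))] with hpt
  have hpS : ∀ m, pt m ∈ movingGraphSurface p A 0 := by
    intro m
    rw [mem_movingGraphSurface_iff]
    constructor
    · rfl
    · simp only [hpt, Sum.elim_inl, Sum.elim_inr, Matrix.cons_val_zero, map_zero, mul_zero, add_zero]
      exact hsys' m
  have hpΓ : ∀ m, pt m ∈ expGraph ℂ 2 := by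
    intro m
    rw [mem_expGraph_iff]
    intro i
    rw [Literature.ModelTheory.ExponentialFields.ExponentialRing.complex_exp_eq]
    fin_cases i <;> rfl
  refine unprojectedDense_of_growth (isIrreducibleClosed_polyFibredGraph _ _ _)
    (zariskiDim_polyFibredGraph _ _ _).le 1 hpS hpΓ ?_
  show Tendsto (fun m => |(p.eval (x m)).re| / Real.log (2 + ‖p.eval (x m)‖)) atTop atTop
  -- ### common data
  set L₁ : ℝ := Real.log (2 + Bp * 2 ^ D) + D * Real.log (3 * Real.pi) with hL₁
  have hL₁pos : 0 < L₁ := by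
    have h1 : 0 < Real.log (2 + Bp * 2 ^ D) := Real.log_pos (by
      have : 0 ≤ Bp * 2 ^ D := by positivity
      linarith)
    have h2 : 0 < Real.log (3 * Real.pi) := Real.log_pos (by linarith [Real.pi_gt_three])
    positivity
  have hlogd : Tendsto (fun m : ℕ => d * Real.log m) atTop atTop :=
    (Real.tendsto_log_atTop.comp tendsto_natCast_atTop_atTop).const_mul_atTop hdpos
  have hexp : ∀ m : ℕ, 1 ≤ (x m).im → 0 ≤ (x m).re → (x m).re ≤ (x m).im →
      |(p.eval (x m)).re - (X * (x m).im ^ D + (c₁ + D * y * (x m).re) * (x m).im ^ (D - 1))| ≤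
        B * (1 + (x m).re) ^ 2 * (x m).im ^ (D - 2) := by
    intro m h1 h2 h3
    have h := hB (x m).re (x m).im h1 h2 h3
    rwa [Complex.re_add_im] at h
  have hctrl' : ∀ m : ℕ, M m = m → |(x m).re - d * Real.log m| ≤ C ∧
      |(x m).im - 2 * Real.pi * m| ≤ C := by
    intro m hMm'
    obtain ⟨hre, him⟩ := hctrl m
    rw [hMm'] at hre him
    simp only [Int.cast_one, mul_one] at him
    exact ⟨hre, him⟩
  by_cases hX0 : X = 0
  · -- ### Case `Re(lc i^D) = 0`
    have hy0 : y ≠ 0 := re_leadingCoeff_mul_I_pow_pred_ne_zero hα0 (by omega) hX0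
    have hypos : 0 < |y| := abs_pos.2 hy0
    have hκ : 0 < D * |y| / 4 * Real.pi ^ (D - 1) := by positivity
    refine tendsto_atTop_mono' atTop ?_
      ((tendsto_div_const_add_mul_log hL₁pos hDpos.le).const_mul_atTop hκ)
    filter_upwards [hMm, hlogd.eventually_ge_atTop (C + 1 + 2 * |c₁| / (D * |y|)),
      eventually_mul_log_add_le d (2 * C) Real.pi_pos,
      eventually_mul_log_add_le (16 * B * d) (16 * B * C) (by positivity : 0 < D * |y| * Real.pi),
      eventually_ge_atTop 1] with m hMm' h1 h2 h3 hm1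
    have hm1' : (1 : ℝ) ≤ m := by exact_mod_cast hm1
    obtain ⟨hre, him⟩ := hctrl' m hMm'
    have hc' : 0 ≤ 2 * |c₁| / (D * |y|) := by positivity
    obtain ⟨hu1, huup, hulo, htlo, htup, hut, hpm⟩ :=
      control_geometry_aux hre him (by linarith) h2
    have hkey := hexp m (hpm.trans htlo) (by linarith) hut
    rw [hX0, zero_mul, zero_add] at hkey
    have hnum := re_lower_of_re_eq_zero hp hy0 hB0 hm1' hu1 huup hulo htlo h1 (by linarith) hkey
    exact ratio_lower_aux hnum
      (by have := log_norm_eval_le_aux p (by linarith) (by linarith) hut (by linarith) htup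
          rw [hL₁]; linarith)
      (Real.log_pos (by linarith [norm_nonneg (p.eval (x m))]))
  · -- ### Case `Re(lc i^D) ≠ 0`
    have hXpos : 0 < |X| := abs_pos.2 hX0
    have hκ : 0 < |X| / 2 * Real.pi ^ D := by positivity
    refine tendsto_atTop_mono' atTop ?_
      ((tendsto_div_const_add_mul_log hL₁pos hDpos.le).const_mul_atTop hκ)
    filter_upwards [hMm, hlogd.eventually_ge_atTop (C + 1),
      eventually_mul_log_add_le d (2 * C) Real.pi_pos,
      eventually_mul_log_add_le (D * |y| * d) (D * |y| * C + |c₁|) (by positivity : 0 < |X| / 4 * Real.pi),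
      eventually_mul_log_add_sq_le d (1 + C) (by positivity : 0 < |X| / 4 * Real.pi / (B + 1)),
      eventually_ge_atTop 1] with m hMm' h1 h2 h3 h4 hm1
    have hm1' : (1 : ℝ) ≤ m := by exact_mod_cast hm1
    obtain ⟨hre, him⟩ := hctrl' m hMm'
    obtain ⟨hu1, huup, -, htlo, htup, hut, hpm⟩ := control_geometry_aux hre him h1 h2
    have hnum := re_lower_of_re_ne_zero hp hX0 hB0 hm1' hu1 huup htlo (by linarith) h4
      (hexp m (hpm.trans htlo) (by linarith) hut)
    exact ratio_lower_aux hnum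
      (by have := log_norm_eval_le_aux p (by linarith) (by linarith) hut (by linarith) htup
          rw [hL₁]; linarith)
      (Real.log_pos (by linarith [norm_nonneg (p.eval (x m))]))

end Summit.Schanuel.Schanuel.Theorems

end
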